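import Literature.Algebra.EuclideanLattices.DiscreteGaussian
import HarnessLib

/-!
# Shifting the centre of a lattice Gaussian by a lattice vector: `D_{L,s,c+ℓ} = ℓ + D_{L,s,c}`

Topic `Algebra/EuclideanLattices` (family `pqc`); a small complement to `DiscreteGaussian.lean`
(`discreteGaussian L s c = D_{L,s,c}`, mass `∝ ρ_s(x - c)` on `L`). Proved (no named fact), for the
consumers of coset sampling in which the centre is only known up to a lattice vector — the Gaussian
randomised rounding of BLPRS 2013, Lemma 3.5 and the step `c ← D_{q⁻¹ℤᵐ - b', r}` of **Lemma 4.7**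
(pqc.S21, `Literature.Computability.Cryptography.blprs_gapSVP_sqrt_dim_to_lwe_classical`): there
`b' = Ue + f + (a lattice vector)` and *"the coset `q⁻¹ℤᵐ - b'` is identical to `q⁻¹ℤᵐ - (Ue + f)`"*
(arXiv:1306.0281, proof of Lemma 4.7), which at the level of laws is the identity below.

## Results (`0 < s`, `c ∈ E`, `ℓ ∈ L`)

* `gaussianMass_lattice_centre_add_coe` — `ρ_{s,c+ℓ}(L) = ρ_{s,c}(L)`;
* `discreteGaussian_apply_centre_add_coe` — `D_{L,s,c+ℓ}(x) = D_{L,s,c}(x - ℓ)`;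
* **`discreteGaussian_centre_add_coe`** — `D_{L,s,c+ℓ} = (D_{L,s,c}).map (· + ℓ)`, and
  `discreteGaussian_centre_add_coe_map_sub` — `(D_{L,s,c+ℓ}).map (· - ℓ) = D_{L,s,c}`.

## References

* D. Micciancio, O. Regev, *Worst-case to average-case reductions based on Gaussian measures*, SIAM J.
  Comput. 37 (2007), §2 (lattice Gaussians) [MicciancioRegev2007].
* Z. Brakerski, A. Langlois, C. Peikert, O. Regev, D. Stehlé, *Classical hardness of learning with errors*,
  STOC 2013; arXiv:1306.0281, proofs of Lemma 3.5 and Lemma 4.7 (coset identities).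
-/

noncomputable section

open scoped ENNReal

namespace Literature.Algebra.EuclideanLattices

variable {E : Type*} [NormedAddCommGroup E] [NormedSpace ℝ E] [FiniteDimensional ℝ E]
variable (L : Submodule ℤ E) [DiscreteTopology L]

omit [NormedSpace ℝ E] [FiniteDimensional ℝ E] [DiscreteTopology L] in
/-- **`ρ_{s,c+ℓ}(L) = ρ_{s,c}(L)`** for a lattice vector `ℓ`: reindex the sum by `x ↦ x + ℓ`.
[cite: MicciancioRegev2007, §2] -/
theorem gaussianMass_lattice_centre_add_coe (s : ℝ) (c : E) (ℓ : L) :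
    gaussianMass s (c + ℓ) (L : Set E) = gaussianMass s c (L : Set E) := by
  unfold gaussianMass
  change ∑' x : L, ENNReal.ofReal (gaussianFunction s ((x : E) - (c + ℓ))) =
    ∑' x : L, ENNReal.ofReal (gaussianFunction s ((x : E) - c))
  rw [← Equiv.tsum_eq (Equiv.addRight ℓ)]
  refine tsum_congr fun x => ?_
  simp only [Equiv.coe_addRight, Submodule.coe_add]
  congr 2
  abel

/-- **`D_{L,s,c+ℓ}(x) = D_{L,s,c}(x - ℓ)`** for `0 < s` and a lattice vector `ℓ`. [cite: MicciancioRegev2007, §2] -/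
theorem discreteGaussian_apply_centre_add_coe {s : ℝ} (hs : 0 < s) (c : E) (ℓ x : L) :
    discreteGaussian L s (c + ℓ) x = discreteGaussian L s c (x - ℓ) := by
  rw [discreteGaussian_apply L hs, discreteGaussian_apply L hs, gaussianMass_lattice_centre_add_coe,
    Submodule.coe_sub]
  congr 3
  abel

/-- **Shifting the centre by a lattice vector shifts the sample**: `D_{L,s,c+ℓ} = (D_{L,s,c}).map (· + ℓ)`
("the coset `q⁻¹ℤᵐ - b'` is identical to `q⁻¹ℤᵐ - (Ue + f)`" at the level of laws).
[cite: BrakerskiEtAl2013, Lemma 4.7 (proof)] -/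
theorem discreteGaussian_centre_add_coe {s : ℝ} (hs : 0 < s) (c : E) (ℓ : L) :
    discreteGaussian L s (c + ℓ) = (discreteGaussian L s c).map fun x => x + ℓ := by
  classical
  refine PMF.ext fun x => ?_
  rw [discreteGaussian_apply_centre_add_coe L hs c ℓ x, PMF.map_apply, tsum_eq_single (x - ℓ)]
  · rw [if_pos (sub_add_cancel x ℓ).symm]
  · intro a ha
    rw [if_neg]
    intro h
    exact ha (by rw [h, add_sub_cancel_right])

/-- Equivalently: sampling from `D_{L,s,c+ℓ}` and subtracting `ℓ` samples `D_{L,s,c}`. [cite: BrakerskiEtAl2013, Lemma 4.7 (proof)] -/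
theorem discreteGaussian_centre_add_coe_map_sub {s : ℝ} (hs : 0 < s) (c : E) (ℓ : L) :
    (discreteGaussian L s (c + ℓ)).map (fun x => x - ℓ) = discreteGaussian L s c := by
  rw [discreteGaussian_centre_add_coe L hs c ℓ, PMF.map_comp]
  convert PMF.map_id _ using 2
  funext x
  simp

end Literature.Algebra.EuclideanLattices

end
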